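import Summits.AtomisticToContinuum.BoseEinsteinCondensation.Theorems.BECCellInformationOneBodyEntropyBoundAeCoreOrAeZero
import Summits.AtomisticToContinuum.BoseEinsteinCondensation.Theorems.BECCellInformationOneBodyEntropyBoundDirichletFloor
import Summits.AtomisticToContinuum.BoseEinsteinCondensation.Theorems.BECCellInformationOneBodyEntropyBoundInsertionIntegrable
import Summits.AtomisticToContinuum.BoseEinsteinCondensation.Theorems.BECCellInformationOneBodyEntropyBoundCutoffAndCount
import Summits.AtomisticToContinuum.BoseEinsteinCondensation.Theorems.BECCellInformationOneBodyEntropyBoundCubeNeumannBound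
import Summits.AtomisticToContinuum.BoseEinsteinCondensation.Theorems.BECCellInformationOneBodyEntropyBoundCagingBound
import Summits.AtomisticToContinuum.BoseEinsteinCondensation.Theorems.BECCellInformationOneBodyEntropyBoundDenseCellMain

/-!
# Crux `OneBodyEntropyBound` (stmt-AtomisticToContinuum-13440) — PARTIAL RESULT of line `registered` (lead c2):
# the one-body profile entropy bound for every INTEGRABLE, a.e.-positive-core, or a.e.-zero pair potential

Support file (`--supports stmt-AtomisticToContinuum-13440`). `oneBodyEntropyBound_of_integrable_or_aeCore_or_aeZero`: for every
repulsive finite-range `v` with `∫ v(|x|) dx < ∞` (bounded or soft potentials, soft and bounded hollow shells, summable shell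
sequences, integrable singular cores), OR with an a.e.-positive core (hard spheres, …), OR a.e. zero on `(0,∞)` (free gas),
the conclusion of `…Theses.BECCellInformation.OneBodyEntropyBound` holds for `v`. The integrable case is NEW: Dirichlet floor
(`stub_dirichletFloor`) + insertion lemma (`stub_insertionIntegrable`) + one-body caging bound
(`stub_cagingBound ∘ stub_cubeNeumannBound`) + cutoff pair / isolated count (`stub_cutoffAndCount`) + the one-particle local
energy bound and densest-cell assembly (`stub_denseCellBound`), then the landed chain rule / within-cell LSI assembly
`Partial.of_coarse`. What remains open for the crux (skeleton `Lines/birth.lean`, stub `stub_insertionResidual`):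
essentially-hollow NON-integrable `v` (e.g. hard hollow shells `⊤·1_[r₁,r₂]`), for which only the insertion lemma is missing.
-/

noncomputable section

namespace Summit.AtomisticToContinuum.BoseEinsteinCondensation.Cruxes.OneBodyEntropyBound.Birth

open MeasureTheory Filter
open scoped ENNReal
open Literature.MathematicalPhysics.QuantumManyBody.BoseGas

/-- **One-body entropy bound for integrable, a.e.-positive-core, or a.e.-zero potentials** (partial result of the crux
`OneBodyEntropyBound`, line `registered`). [folklore] -/
theorem oneBodyEntropyBound_of_integrable_or_aeCore_or_aeZero (v : ℝ → ENNReal) (hv : IsRepulsiveFiniteRange v)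
    (h : (∫⁻ x : EuclideanSpace ℝ (Fin 3), v ‖x‖) ≠ ⊤ ∨
      (∃ c : ENNReal, ∃ r₀ : ℝ, 0 < c ∧ 0 < r₀ ∧
        ∀ᵐ r : ℝ ∂(MeasureTheory.volume.restrict (Set.Ioc (0 : ℝ) r₀)), c ≤ v r) ∨
      (∀ᵐ r : ℝ ∂(MeasureTheory.volume.restrict (Set.Ioi (0 : ℝ))), v r = 0)) :
    ∃ ρ₀ : ℝ, 0 < ρ₀ ∧ ∀ ρ : ℝ, 0 < ρ → ρ < ρ₀ → ∃ C : ℝ,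
      ∀ᶠ n : ℕ in Filter.atTop, ∃ δ : ENNReal, 0 < δ ∧ ∀ Ψ :
      Literature.MathematicalPhysics.QuantumManyBody.BoseGas.TrialState (n + 1)
      (Literature.MathematicalPhysics.QuantumManyBody.BoseGas.sideLength ρ (n + 1)),
      Literature.MathematicalPhysics.QuantumManyBody.BoseGas.energy v Ψ ≤
      Literature.MathematicalPhysics.QuantumManyBody.BoseGas.groundStateEnergy v (n + 1)
      (Literature.MathematicalPhysics.QuantumManyBody.BoseGas.sideLength ρ (n + 1)) + δ → ∫⁻ x in
      Literature.MathematicalPhysics.QuantumManyBody.BoseGas.box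
      (Literature.MathematicalPhysics.QuantumManyBody.BoseGas.sideLength ρ (n + 1)), ENNReal.ofReal
      ((Literature.MathematicalPhysics.QuantumManyBody.BoseGas.sideLength ρ (n + 1) ^ 3)⁻¹ *
      InformationTheory.klFun (Literature.MathematicalPhysics.QuantumManyBody.BoseGas.sideLength ρ
      (n + 1) ^ 3 * (∫ Y' : Literature.MathematicalPhysics.QuantumManyBody.BoseGas.Config n, ‖Ψ.ψ
      (Matrix.vecCons x Y')‖ ^ 2))) ≤ ENNReal.ofReal C := by
  rcases h with hint | hcore | hz
  · by_cases hz : (∀ᵐ r : ℝ ∂(MeasureTheory.volume.restrict (Set.Ioi (0 : ℝ))), v r = 0)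
    · exact oneBodyEntropyBound_of_aeCore_or_aeZero v hv (Or.inr hz)
    · exact Partial.of_coarse v hv
        (stub_denseCellBound stub_dirichletFloor (stub_cagingBound stub_cubeNeumannBound) stub_cutoffAndCount v hv hz
          (stub_insertionIntegrable stub_dirichletFloor v hv hint))
  · exact oneBodyEntropyBound_of_aeCore_or_aeZero v hv (Or.inl hcore)
  · exact oneBodyEntropyBound_of_aeCore_or_aeZero v hv (Or.inr hz)

/-- **Registered partial-result stub `stub_oneBodyEntropyBound_integrableOrCoreOrZero`** (line `registered`): the crux
conclusion for every admissible `v` that is integrable in `ℝ³`, or has an a.e.-positive core, or is a.e. zero on `(0,∞)`.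
[folklore] -/
theorem stub_oneBodyEntropyBound_integrableOrCoreOrZero :
    ∀ v : ℝ → ENNReal, Literature.MathematicalPhysics.QuantumManyBody.BoseGas.IsRepulsiveFiniteRange v →
      ((∫⁻ x : EuclideanSpace ℝ (Fin 3), v ‖x‖) ≠ ⊤ ∨
        (∃ c : ENNReal, ∃ r₀ : ℝ, 0 < c ∧ 0 < r₀ ∧
          ∀ᵐ r : ℝ ∂(MeasureTheory.volume.restrict (Set.Ioc (0 : ℝ) r₀)), c ≤ v r) ∨
        (∀ᵐ r : ℝ ∂(MeasureTheory.volume.restrict (Set.Ioi (0 : ℝ))), v r = 0)) →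
      ∃ ρ₀ : ℝ, 0 < ρ₀ ∧ ∀ ρ : ℝ, 0 < ρ → ρ < ρ₀ → ∃ C : ℝ,
        ∀ᶠ n : ℕ in Filter.atTop, ∃ δ : ENNReal, 0 < δ ∧ ∀ Ψ :
        Literature.MathematicalPhysics.QuantumManyBody.BoseGas.TrialState (n + 1)
        (Literature.MathematicalPhysics.QuantumManyBody.BoseGas.sideLength ρ (n + 1)),
        Literature.MathematicalPhysics.QuantumManyBody.BoseGas.energy v Ψ ≤
        Literature.MathematicalPhysics.QuantumManyBody.BoseGas.groundStateEnergy v (n + 1)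
        (Literature.MathematicalPhysics.QuantumManyBody.BoseGas.sideLength ρ (n + 1)) + δ → ∫⁻ x in
        Literature.MathematicalPhysics.QuantumManyBody.BoseGas.box
        (Literature.MathematicalPhysics.QuantumManyBody.BoseGas.sideLength ρ (n + 1)), ENNReal.ofReal
        ((Literature.MathematicalPhysics.QuantumManyBody.BoseGas.sideLength ρ (n + 1) ^ 3)⁻¹ *
        InformationTheory.klFun (Literature.MathematicalPhysics.QuantumManyBody.BoseGas.sideLength ρ
        (n + 1) ^ 3 * (∫ Y' : Literature.MathematicalPhysics.QuantumManyBody.BoseGas.Config n, ‖Ψ.ψ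
        (Matrix.vecCons x Y')‖ ^ 2))) ≤ ENNReal.ofReal C :=
  fun v hv h => oneBodyEntropyBound_of_integrable_or_aeCore_or_aeZero v hv h

end Summit.AtomisticToContinuum.BoseEinsteinCondensation.Cruxes.OneBodyEntropyBound.Birth

end
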